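import Summits.Parity.BatemanHorn.Theorems.SoloInformedThinTypeIModel
import HarnessLib

/-!
# Thin sequences vs. Type-I information, VII: the constant model has prime mass (consistency of VI)

Solo unit `solo-Parity-informed` (ideation tier, informed mode), session 26; `PLAN.md` §34, CLAIMS C105.
Companion of `SoloInformedThinTypeIModel`, whose `eventually_not_typeI_of_sparse_model` refutes
Ford–Maynard's (I) for `w = a − b`, `a` thin, against every model `b` carrying prime mass on a
dyadic block `(M, 2M]`, `x^{1-c} log² x ≤ M ≤ x^γ/2` (total `≥ β·x/log M`, per prime `≤ R₀·x/M`).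
This file checks that the two mass hypotheses are met by the constant model `b = 1`
(`modelMass_one_le`: per prime `≤ x/(2M) + 1`; `exists_sum_modelMass_one_ge`: total
`≥ β·x/log M` with an absolute `β > 0`, from Chebyshev's bound `#{p ∈ (M, 2M]} ≥ M/(K log 2M)`,
`exists_card_primes_Ioc_two_mul_ge`) and re-derives the `b = 1` theorem
`SoloInformedThinTypeI.eventually_not_typeI_of_sparse` from the model-robust one (the closing
`example`) — so the hypotheses of the model-robust theorem are not vacuous and it is a genuine
generalisation.

References: [cite: FordMaynard2024PrimeSieves, §1 (I); §2.4 (p. 7)].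
-/

noncomputable section

open Filter Finset Real

namespace Summit.Parity.BatemanHorn.Theorems

open Literature.Barriers.Parity.FordMaynard (TypeI eventually_mul_rpow_le_rpow)

/-! ### The constant model has prime mass: consistency with `SoloInformedThinTypeI` -/

/-- For `b = 1`: the mass on the multiples of `p > M > 0` is at most `x/(2M) + 1`. -/
theorem modelMass_one_le {x M : ℝ} (hx : 0 ≤ x) (hM : 0 < M) {p : ℕ} (hMp : M < (p : ℝ)) :
    modelMass (fun _ => (1 : ℝ)) x p ≤ x / (2 * M) + 1 := by
  have hp0 : (0 : ℝ) < p := hM.trans hMp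
  unfold modelMass
  rw [sum_const, nsmul_eq_mul, mul_one]
  have hsub : (Icc 1 ⌊x⌋₊).filter (fun n : ℕ => x / 2 < (p * n : ℝ) ∧ (p * n : ℝ) ≤ x) ⊆
      Ioc ⌊x / (2 * p)⌋₊ ⌊x / p⌋₊ := by
    intro n hn
    rw [Finset.mem_filter, mem_Icc] at hn
    obtain ⟨-, h1, h2⟩ := hn
    rw [mem_Ioc, Nat.floor_lt (by positivity), Nat.le_floor_iff (by positivity),
      div_lt_iff₀ (by positivity), le_div_iff₀ hp0]
    constructor <;> linarith
  have hfl : ⌊x / (2 * p)⌋₊ ≤ ⌊x / p⌋₊ :=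
    Nat.floor_le_floor (div_le_div_of_nonneg_left hx hp0 (by linarith))
  have hIoc : ((Ioc ⌊x / (2 * p)⌋₊ ⌊x / p⌋₊).card : ℝ) ≤ x / (2 * p) + 1 := by
    rw [Nat.card_Ioc, Nat.cast_sub hfl]
    have h1 : (⌊x / p⌋₊ : ℝ) ≤ x / p := Nat.floor_le (by positivity)
    have h2 : x / (2 * p) < ⌊x / (2 * p)⌋₊ + 1 := Nat.lt_floor_add_one _
    have h4 : x / p = 2 * (x / (2 * p)) := by
      field_simp
    linarith
  have hmono : x / (2 * p) ≤ x / (2 * M) :=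
    div_le_div_of_nonneg_left hx (by positivity) (by linarith)
  calc (((Icc 1 ⌊x⌋₊).filter
          (fun n : ℕ => x / 2 < (p * n : ℝ) ∧ (p * n : ℝ) ≤ x)).card : ℝ)
      ≤ ((Ioc ⌊x / (2 * p)⌋₊ ⌊x / p⌋₊).card : ℝ) := by exact_mod_cast card_le_card hsub
    _ ≤ x / (2 * M) + 1 := by linarith

/-- For `b = 1`: the primes of a dyadic block `(M, 2M]`, `2 ≤ M ≤ x/8`, carry mass
`≥ β·x/log M` for an absolute `β > 0` (Chebyshev, via `exists_card_primes_Ioc_two_mul_ge`). -/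
theorem exists_sum_modelMass_one_ge :
    ∃ β : ℝ, 0 < β ∧ ∀ x : ℝ, 0 ≤ x → ∀ M : ℕ, 2 ≤ M → (M : ℝ) ≤ x / 8 →
      β * x / Real.log M ≤
        ∑ p ∈ (Ioc M (2 * M)).filter Nat.Prime, modelMass (fun _ => (1 : ℝ)) x p := by
  obtain ⟨K, hK1, hK⟩ := exists_card_primes_Ioc_two_mul_ge
  have hK0 : 0 < K := by linarith
  refine ⟨1 / (16 * K), by positivity, fun x hx M hM2 hM8 => ?_⟩
  set S : Finset ℕ := (Ioc M (2 * M)).filter Nat.Prime with hSdef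
  have hMr : (2 : ℝ) ≤ M := by exact_mod_cast hM2
  have hM0 : (0 : ℝ) < M := by linarith
  have hlM : Real.log 2 ≤ Real.log M := Real.log_le_log two_pos hMr
  have hl2 : 0 < Real.log 2 := Real.log_pos one_lt_two
  have hlM0 : 0 < Real.log M := by linarith
  have hlog2M : Real.log (2 * M) = Real.log 2 + Real.log M :=
    Real.log_mul two_ne_zero hM0.ne'
  have hl2M0 : 0 < Real.log (2 * M) := by rw [hlog2M]; linarith
  have hl2Mle : Real.log (2 * M) ≤ 2 * Real.log M := by rw [hlog2M]; linarith
  -- each prime of the block carries at least `x/(8M)`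
  have hterm : ∀ p ∈ S, x / (8 * M) ≤ modelMass (fun _ => (1 : ℝ)) x p := by
    intro p hp
    rw [hSdef, mem_filter, mem_Ioc] at hp
    have hp0 : 0 < p := hp.2.pos
    have hp2M : (p : ℝ) ≤ 2 * M := by exact_mod_cast hp.1.2
    have hpr0 : (0 : ℝ) < p := by exact_mod_cast hp0
    have h1 : x / (2 * p) - 1 ≤ modelMass (fun _ => (1 : ℝ)) x p := sub_one_le_modelMass_one hx hp0
    have h2 : x / (4 * M) ≤ x / (2 * p) :=
      div_le_div_of_nonneg_left hx (by positivity) (by linarith)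
    have h3 : x / (8 * M) = x / (4 * M) - x / (8 * M) := by ring
    have h4 : 1 ≤ x / (8 * M) := by
      rw [le_div_iff₀ (by positivity)]
      linarith
    linarith
  have hcard : (M : ℝ) / (K * Real.log (2 * M)) ≤ (S.card : ℝ) := hK M (by omega)
  have hsum : (S.card : ℝ) * (x / (8 * M)) ≤ ∑ p ∈ S, modelMass (fun _ => (1 : ℝ)) x p := by
    rw [← nsmul_eq_mul, ← sum_const]
    exact sum_le_sum hterm
  have h5 : (M : ℝ) / (K * Real.log (2 * M)) * (x / (8 * M)) ≤ (S.card : ℝ) * (x / (8 * M)) :=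
    mul_le_mul_of_nonneg_right hcard (by positivity)
  have h6 : (M : ℝ) / (K * Real.log (2 * M)) * (x / (8 * M)) = x / (8 * K * Real.log (2 * M)) := by
    field_simp
  have h7 : 1 / (16 * K) * x / Real.log M ≤ x / (8 * K * Real.log (2 * M)) := by
    rw [show 1 / (16 * K) * x / Real.log M = x / (16 * K * Real.log M) by
      field_simp]
    apply div_le_div_of_nonneg_left hx (by positivity)
    nlinarith
  linarith

/-- **Consistency** (an `example`: the statement is the landed
`SoloInformedThinTypeI.eventually_not_typeI_of_sparse`, re-derived here from the model-robust
theorem).  The constant model `b = 1` meets both mass hypotheses of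
`eventually_not_typeI_of_sparse_model` on the block `M = ⌈x^{1-c} log² x⌉`; hence for `0 < c ≤ 1`,
`γ > 1 − c`, `B > 1` and all large `x`, no real sequence with at most `x^{1-c}` non-zero values on
`(x/2, x]` has `w = a − 1` satisfying (I) at level `x^γ`. [cite: FordMaynard2024PrimeSieves, §2.4] -/
example {c γ B : ℝ} (hc : 0 < c) (hc1 : c ≤ 1) (hγ : 1 - c < γ) (hB : 1 < B) :
    ∀ᶠ x : ℝ in atTop, ∀ (a : ℕ → ℝ) (A : Finset ℕ), (A.card : ℝ) ≤ x ^ (1 - c) →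
      (∀ v : ℕ, x / 2 < (v : ℝ) → (v : ℝ) ≤ x → a v ≠ 0 → v ∈ A) →
      ¬ TypeI (fun n : ℕ => a n - 1) x γ B := by
  obtain ⟨β, hβ, hmass⟩ := exists_sum_modelMass_one_ge
  -- work at the level `γ' = min γ (1 - c/2)`, so that the block sits below `x/8`
  set γ' : ℝ := min γ (1 - c / 2) with hγ'def
  have hγ' : 1 - c < γ' := lt_min hγ (by linarith)
  have hγ'γ : γ' ≤ γ := min_le_left _ _
  have hγ'1 : γ' ≤ 1 - c / 2 := min_le_right _ _
  set η : ℝ := (γ' - (1 - c)) / 2 with hηdef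
  have hη : 0 < η := by rw [hηdef]; linarith
  have hgap : 1 - c + η < γ' := by rw [hηdef]; linarith
  filter_upwards [eventually_not_typeI_of_sparse_model hc1 hγ' hB hβ zero_le_one,
    eventually_ge_atTop (1 : ℝ),
    (isLittleO_log_rpow_rpow_atTop 2 hη).bound one_pos,
    eventually_mul_rpow_le_rpow 4 hgap,
    eventually_mul_rpow_le_rpow 4 (by linarith : 1 - c / 2 < 1),
    Real.tendsto_log_atTop.eventually_ge_atTop (2 : ℝ)]
    with x hmodel hx1 hlog e1 e2 hlx2 a A hA hcov hI
  rw [Real.rpow_one] at e2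
  have hx0 : 0 < x := by linarith
  have hx1c : 1 ≤ x ^ (1 - c) := Real.one_le_rpow hx1 (by linarith)
  -- `log² x ≤ x^η`
  have hlog' : Real.log x ^ 2 ≤ x ^ η := by
    have h := hlog
    simp only [one_mul, Real.norm_eq_abs, Real.rpow_two] at h
    have h2 : |x ^ η| = x ^ η := abs_of_nonneg (Real.rpow_nonneg hx0.le _)
    rw [h2] at h
    exact (le_abs_self _).trans h
  -- the block
  set M : ℕ := ⌈x ^ (1 - c) * Real.log x ^ 2⌉₊ with hMdef
  have hMlo : x ^ (1 - c) * Real.log x ^ 2 ≤ (M : ℝ) := Nat.le_ceil _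
  have hMlt : (M : ℝ) < x ^ (1 - c) * Real.log x ^ 2 + 1 := Nat.ceil_lt_add_one (by positivity)
  have hprod : x ^ (1 - c) * Real.log x ^ 2 ≤ x ^ (1 - c + η) := by
    rw [Real.rpow_add hx0]
    exact mul_le_mul_of_nonneg_left hlog' (by positivity)
  have hpow1 : 1 ≤ x ^ (1 - c + η) := Real.one_le_rpow hx1 (by linarith)
  have hMhi : 2 * (M : ℝ) ≤ x ^ γ' := by linarith
  have hγ'pow : x ^ γ' ≤ x ^ (1 - c / 2) := Real.rpow_le_rpow_of_exponent_le hx1 hγ'1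
  have hM8 : (M : ℝ) ≤ x / 8 := by linarith
  have hM4 : (4 : ℝ) ≤ M := by
    have : (4 : ℝ) ≤ Real.log x ^ 2 := by nlinarith
    have h' : Real.log x ^ 2 ≤ x ^ (1 - c) * Real.log x ^ 2 :=
      le_mul_of_one_le_left (by positivity) hx1c
    linarith
  have hM2 : 2 ≤ M := by exact_mod_cast (show (2 : ℝ) ≤ M by linarith)
  have hM0 : (0 : ℝ) < M := by linarith
  -- the two mass hypotheses for `b = 1`
  have hper : ∀ p : ℕ, p.Prime → M < p → p ≤ 2 * M →
      modelMass (fun _ => (1 : ℝ)) x p ≤ 1 * x / M := by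
    intro p _ hMp _
    have h1 := modelMass_one_le hx0.le hM0 (show (M : ℝ) < p by exact_mod_cast hMp)
    have h2 : x / (2 * M) + 1 ≤ 1 * x / M := by
      rw [one_mul]
      have h3 : x / M = 2 * (x / (2 * M)) := by
        field_simp
      have h4 : 1 ≤ x / (2 * M) := by
        rw [le_div_iff₀ (by positivity)]
        linarith
      linarith
    exact h1.trans h2
  exact hmodel a (fun _ => (1 : ℝ)) A M hA hcov hMlo hMhi hper (hmass x hx0.le M hM2 hM8)
    (Literature.Barriers.Parity.FordMaynard.TypeI.mono_level hx1 hγ'γ hI)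

end Summit.Parity.BatemanHorn.Theorems

end
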